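/-
Copyright (c) 2026 the pub-hodgecm-mathlib formalisation cell (harness21).  Prover seat hodgecm-mathlib-K2E3-p29 (g0), HCML Track B «K2-LIT» (build stream 29),
h413 = `stmt-HodgeConjecture-24833`, line `K2_E3_EllipticInputs`, unit U12 «Characters», PART «SC» leaf (SC-an)₂ (road «FC₂», CLOSE-OUT DAY strike line L4 `stub_StCharTS`,
LINE-LEAD K2E3-plan (g4), deal D135 sequel «(ε)₂ RE-THREAD» FILE 1 OF 3 «(ε-Lie₂)»): `‖disc χ_X‖_K^{−r}` is locally `∫⁻`-finite on the Lie algebra `𝔲(σ, Φ₂)(K) = 𝔲(1,1)` for EVERY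
real exponent `r` with `2r < 1` — the exponent-parametric twin of ★ K2E3-p27's (HCD₂-LIE) `K2E3U11WeylDiscrLieLocInt` (which is the case `r = 1∕4`).  2026-09-04.
-/
import Summits.HodgeConjecture.HodgeConjecture.Theorems.K2E3U11WeylDiscrLieLocInt   -- ★ (HCD₂-LIE) p860721 (K2E3-p27): `exists_coords_lie_two`, `discr_charpoly_two_of_entries`, `gram_ternary_isSymm ∕ _det_ne_zero`, `dotProduct_gram_ternary`, `exists_prodChart_four`; brings ★ (D3b), ★ (G-FUB)
import HarnessLib

/-!
# h413 ∕ Track B «K2-LIT», (SC-an)₂ ∕ (M5h)₂ — «(ε)₂ RE-THREAD» FILE 1 «(ε-Lie₂)»: `‖disc χ_X‖_K^{−r}` IS LOCALLY `∫⁻`-FINITE ON `𝔲(1,1) = 𝔲(σ, Φ₂)(K)` FOR `2r < 1`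
# (Harish-Chandra 1970 Part VII §1 Thm. 15 on the Lie algebra, rank one, with ε-room: `|η|^{−1∕2−ε}`)

Cell `pub/hodgecm-mathlib` (D-0151), Track B «K2-LIT», crux H413 = `stmt-HodgeConjecture-24833`, route `HCCMUnconditional`.  Lane `--supports stmt-HodgeConjecture-24833
--as helper`; THEOREMS ONLY (no `def`, no `instance`, no `notation`, no named-fact hypothesis, no `sorry`); count-neutral.  Dealer K2E3-plan (g4) deal D135 (L4 EMIT #1
2026-09-04T14:52:25Z) and this seat's R0 census 14:55:02Z: the (M5h)₂ weight kit ★ p861141 `K2E3SupercuspidalTruncatedCharWeightKitTwo` takes the rank-one (ε6)₂ letter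
`∫⁻_U (↑(|disc χ_g|·|det g|⁻²))^{−(1+1∕4)∕4} ∂ν < ∞` hypothesis-first; the «(ε)₂ re-thread» = this file (Lie algebra), FILE 2 «(ε-Cayley₂)» (group ⟸ Lie algebra), FILE 3
«(ε-Model₂)» (the place model `U(σ_w, Φ₂)(L_w)`) discharges it.

SETTING (verbatim ★ (HCD₂-LIE)'s).  `K` a non-archimedean local field with a ring involution `σ` (`hσ`), `2 ∈ Kˣ`; `F′` a non-archimedean local field with a CLOSED EMBEDDING
`ι : F′ →+* K` whose image is the fixed field of `σ` (`hιr`), a SKEW unit `lam` (`σ lam = −lam`) and the quadratic norm bridge `hιn : ‖ι y‖_K = ‖y‖_{F′}²`; the Lie algebra of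
`U(σ, Φ₂)(K)`, `Φ₂ = !![0,1;1,0]`, as an ARBITRARY additive subgroup `𝔲 ≤ M₂(K)` with `h𝔲 : X ∈ 𝔲 ↔ (X.map σ)ᵀ Φ₂ + Φ₂ X = 0`.

THE MATHEMATICS.  ★ (HCD₂-LIE) proves the case `r = 1∕4` (`(√√‖disc χ_X‖_K)⁻¹ = ‖disc χ_X‖_K^{−1∕4}`); its proof is exponent-free up to the last step: in the `F′`-chart
`Φ : (Fin 4 → F′) ≃ₜ+ ↥𝔲` (★ `exists_coords_lie_two`) one has `disc χ_X = ι(4(x² + mβγ))` (★ `discr_charpoly_two_of_entries`), so by the norm bridge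
`‖disc χ_X‖_K^{−r} = ‖Q(x, β, γ)‖_{F′}^{−2r}` with `Q` the NON-DEGENERATE TERNARY form of Gram matrix `!![4,0,0;0,0,2m;0,2m,0]` (★ `gram_ternary_det_ne_zero`), not involving the
centre coordinate; ★ (D3b) `forall_exists_nhds_setLIntegral_ternaryQuadraticForm_rpow_neg_lt_top` gives `‖Q‖^{−s} ∈ L¹_loc(F′³)` for EVERY `s < 1` (here `s = 2r`), and the
★ (G-FUB) product ∕ one-factor transfers move the statement onto `↥𝔲` exactly as in ★ (HCD₂-LIE).  The admissible range `2r < 1` is sharp (`‖Q‖^{−1} ∉ L¹_loc`); the (M5h)₂ kit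
consumes `r = (1 + 1∕4)∕4 = 5∕16`.
* §1 `coe_rpow_neg_eq_of_normAbs_eq_sq` — the `rpow` norm bridge: `‖ι q‖_K = ‖q‖_{F′}² ⇒ (↑‖ι q‖_K)^{−r} = (↑‖q‖_{F′})^{−2r}` in `[0, ∞]`.
* §2 `eta_rpow_coords_eq` — the integrand in coordinates: `(↑‖disc χ_{Φ a}‖_K)^{−r} = (↑‖4(a₀² + m a₂a₃)‖_{F′})^{−2r}`.
* §3 **`forall_exists_nhds_setLIntegral_eta_rpow_lt_top_lie_two`** — THE HEAD: for `2r < 1`, every additive Haar measure `μ₀` on `↥𝔲` and every `X₀ : ↥𝔲`,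
  `∃ U ∈ 𝓝 X₀, ∫⁻ X in U, (↑‖disc χ_X‖_K)^{−r} ∂μ₀ < ∞` (the `hLie` letter of FILE 2 «(ε-Cayley₂)», the `2 × 2` twin of ★ (ε5)'s `hLie`).

HONEST LABEL: HC_CM is proved only modulo the 7 printed citations (2 remaining named inputs: hLiu418 = stmt-HodgeConjecture-24832, h413 = stmt-HodgeConjecture-24833) until rung 0
closes; count-neutral helper of the (SC-an)₂ ∕ (M5h)₂ road; nothing printed is asserted as a fact; (SC-an)₂ stays OPEN.

## References
* [HarishChandra1970] Harish-Chandra (notes by G. van Dijk), *Harmonic analysis on reductive p-adic groups*, LNM 162 (1970), Part VII §1 Thm. 15 (`|D|^{−1∕2−ε} ∈ L¹_loc`;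
  on the Lie algebra `|η|^{−1∕2−ε}`), §7.
* [Rogawski1990] J. D. Rogawski, *Automorphic Representations of Unitary Groups in Three Variables*, Ann. of Math. Stud. 123 (1990), §1.9 p. 13 (`U(1,1)`), §4.9 p. 54.
* [WeilBNT1967] A. Weil, *Basic Number Theory* (1967), Ch. I §2 (the normalised absolute value under finite extensions), Ch. II §1 (Haar measure on `Kⁿ`).
* [Folland1999] G. B. Folland, *Real Analysis* (2nd ed., 1999), §2.5 Thm. 2.37 (product measures), §11.1.
-/

set_option autoImplicit false
-- the mandated namespace repeats the single-problem summit's segment (`HodgeConjecture.HodgeConjecture`)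
set_option linter.dupNamespace false

noncomputable section

open MeasureTheory MeasureTheory.Measure Filter Topology Set Matrix
open scoped ENNReal NNReal
open Literature.NumberTheory.GaloisRepresentations Literature.NumberTheory.GaloisRepresentations.IsNonarchimedeanLocalField
open Literature.NumberTheory.Automorphic Literature.NumberTheory.Automorphic.LocalFieldHaar Literature.MeasureTheory.Group Literature.NumberTheory.LocalFields
open Summit.HodgeConjecture.HodgeConjecture.Cruxes.H413.F0P3cStCharTSQuadraticFormNegHalf (forall_exists_nhds_setLIntegral_ternaryQuadraticForm_rpow_neg_lt_top)
open Summit.HodgeConjecture.HodgeConjecture.Cruxes.H413.K2E3U11WeylDiscrLieLocInt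

namespace Summit.HodgeConjecture.HodgeConjecture.Cruxes.H413.K2E3U11WeylDiscrLieLocIntRpow

/-! ## §1 The `rpow` norm bridge -/

section Bridge

/-- **`(↑(a²))^(−r) = (↑a)^(−2r)`** in `[0, ∞]` for `a : ℝ≥0` and every real `r` (`ENNReal.rpow_mul`, `ENNReal.rpow_natCast`). [cite: WeilBNT1967, Ch. I §2] -/
theorem coe_sq_rpow_neg (a : ℝ≥0) (r : ℝ) : (((a ^ 2 : ℝ≥0)) : ℝ≥0∞) ^ (-r) = ((a : ℝ≥0∞)) ^ (-(2 * r)) := by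
  rw [ENNReal.coe_pow, ← ENNReal.rpow_natCast, ← ENNReal.rpow_mul]
  congr 1
  push_cast
  ring

variable {K : Type*} [Field K] [ValuativeRel K] [TopologicalSpace K] [IsNonarchimedeanLocalField K]
  {F' : Type*} [Field F'] [ValuativeRel F'] [TopologicalSpace F'] [IsNonarchimedeanLocalField F']

/-- **THE `rpow` NORM BRIDGE**: if `‖ι y‖_K = ‖y‖_{F′}²` for all `y` (★ (NB) `normAbs_map_eq_sq_of_involution` in the model), then `(↑‖ι q‖_K)^(−r) = (↑‖q‖_{F′})^(−2r)` in `[0, ∞]`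
for every `q : F′` and every real `r` (the exponent-parametric twin of ★ `coe_sqrt_sqrt_inv_eq_rpow_neg_half_of_eq_sq`, which is `r = 1∕4`). [cite: WeilBNT1967, Ch. I §2 Cor. 3 of Thm. 3] -/
theorem coe_rpow_neg_eq_of_normAbs_eq_sq (ι : F' →+* K) (hιn : ∀ y : F', normAbs K (ι y) = normAbs F' y ^ 2) (q : F') (r : ℝ) :
    ((normAbs K (ι q) : ℝ≥0∞)) ^ (-r) = ((normAbs F' q : ℝ≥0∞)) ^ (-(2 * r)) := by
  rw [hιn q]
  exact coe_sq_rpow_neg _ r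

end Bridge

/-! ## §2 The integrand `(↑‖disc χ_X‖_K)^(−r)` in the `F′`-chart -/

section Integrand

variable {K : Type*} [Field K] [ValuativeRel K] [TopologicalSpace K] [IsNonarchimedeanLocalField K]
  {F' : Type*} [Field F'] [ValuativeRel F'] [TopologicalSpace F'] [IsNonarchimedeanLocalField F']

/-- **The integrand in coordinates, exponent `r`**: if `↑(Φ a) = !![ι a₀ + lam·ι a₁, lam·ι a₂; lam·ι a₃, −ι a₀ + lam·ι a₁]`, `lam² = ι m` and `‖ι y‖_K = ‖y‖_{F′}²`, then
`(↑‖disc χ_{Φ a}‖_K)^(−r) = (↑‖4(a₀² + m a₂a₃)‖_{F′})^(−2r)` (★ `discr_charpoly_two_of_entries` + §1).  The case `r = 1∕4` is ★ `K2E3U11WeylDiscrLieLocInt.etaInv_coords_eq`.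
[cite: WeilBNT1967, Ch. I §2 Cor. 3 of Thm. 3] [cite: HarishChandra1970, Part VII §7] -/
theorem eta_rpow_coords_eq (ι : F' →+* K) (hιn : ∀ y : F', normAbs K (ι y) = normAbs F' y ^ 2) (lam : Kˣ) {m : F'} (hm : ι m = (lam : K) ^ 2)
    {𝔲 : AddSubgroup (Matrix (Fin 2) (Fin 2) K)} (Φ : (Fin 4 → F') ≃ₜ+ ↥𝔲)
    (hΦ : ∀ a : Fin 4 → F', ((Φ a : ↥𝔲) : Matrix (Fin 2) (Fin 2) K) =
      !![ι (a 0) + (lam : K) * ι (a 1), (lam : K) * ι (a 2); (lam : K) * ι (a 3), -ι (a 0) + (lam : K) * ι (a 1)])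
    (r : ℝ) (a : Fin 4 → F') :
    ((normAbs K (Matrix.charpoly ((Φ a : ↥𝔲) : Matrix (Fin 2) (Fin 2) K)).discr : ℝ≥0∞)) ^ (-r) =
      ((normAbs F' (4 * (a 0 ^ 2 + m * (a 2 * a 3))) : ℝ≥0∞)) ^ (-(2 * r)) := by
  rw [hΦ a, discr_charpoly_two_of_entries ι lam hm]
  exact coe_rpow_neg_eq_of_normAbs_eq_sq ι hιn _ r

end Integrand

/-! ## §3 THE HEAD: `(↑‖disc χ_X‖_K)^(−r)` is locally `∫⁻`-finite on `𝔲(1,1)` for `2r < 1` -/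

section Head

/-- **(ε-Lie₂) HEAD — `‖disc χ_X‖_K^{−r}` IS LOCALLY `∫⁻`-FINITE ON `𝔲(σ, Φ₂)(K) = 𝔲(1,1)` FOR EVERY REAL `r` WITH `2r < 1`**, at EVERY point, for EVERY additive Haar measure `μ₀` on
`↥𝔲` (frame of the module docstring: `σ` an involution of the local field `K` with fixed field `ι(F′)`, `ι` a closed embedding, `lam` a skew unit, `hιn` the quadratic norm bridge,
`2 ∈ Kˣ`).  PROOF (★ (HCD₂-LIE)'s, with the exponent threaded): the chart `Φ` (★ `exists_coords_lie_two`) reads the integrand as `‖4(x² + mβγ)‖_{F′}^{−2r}` (§2), independent of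
the centre coordinate; ★ (D3b) `forall_exists_nhds_setLIntegral_ternaryQuadraticForm_rpow_neg_lt_top` (`‖Q‖^{−s} ∈ L¹_loc(F′³)` for the non-degenerate ternary form `Q` of Gram
matrix `!![4,0,0;0,0,2m;0,2m,0]`, ★ `gram_ternary_det_ne_zero`, every `s < 1`; here `s = 2r`); ★ (G-FUB) `forall_exists_nhds_setLIntegral_lt_top_iff_of_prod` absorbs the idle
coordinate (★ `exists_prodChart_four`, ★ `dotProduct_gram_ternary`) and ★ (G-FUB) `…_iff_of_addEquiv` moves the statement onto `↥𝔲` along `Φ`.  The case `r = 1∕4` is ★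
`K2E3U11WeylDiscrLieLocInt.forall_exists_nhds_setLIntegral_etaInv_lt_top_lie_two`; FILE 2 «(ε-Cayley₂)» consumes this as its `hLie` letter.
[cite: HarishChandra1970, Part VII §1 Thm. 15, §7] [cite: WeilBNT1967, Ch. II §1] [cite: Folland1999, §2.5 Thm. 2.37, §11.1 Thm. 11.9] -/
theorem forall_exists_nhds_setLIntegral_eta_rpow_lt_top_lie_two
    {K : Type*} [Field K] [ValuativeRel K] [TopologicalSpace K] [IsNonarchimedeanLocalField K]
    (σ : K →+* K) (hσ : ∀ x, σ (σ x) = x) [Invertible (2 : K)]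
    {F' : Type*} [Field F'] [ValuativeRel F'] [TopologicalSpace F'] [IsNonarchimedeanLocalField F']
    (ι : F' →+* K) (hι : IsClosedEmbedding ι) (hιr : ∀ x, σ x = x ↔ x ∈ Set.range ι) (lam : Kˣ) (hlam : σ lam = -lam)
    (hιn : ∀ y : F', normAbs K (ι y) = normAbs F' y ^ 2)
    (𝔲 : AddSubgroup (Matrix (Fin 2) (Fin 2) K)) (h𝔲 : ∀ X, X ∈ 𝔲 ↔ (X.map σ)ᵀ * !![(0 : K), 1; 1, 0] + !![(0 : K), 1; 1, 0] * X = 0)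
    [MeasurableSpace ↥𝔲] [BorelSpace ↥𝔲] (μ₀ : Measure ↥𝔲) [μ₀.IsAddHaarMeasure] {r : ℝ} (hr : 2 * r < 1) :
    ∀ X₀ : ↥𝔲, ∃ U ∈ 𝓝 X₀, ∫⁻ X in U,
      ((normAbs K (Matrix.charpoly (X : Matrix (Fin 2) (Fin 2) K)).discr : ℝ≥0∞)) ^ (-r) ∂μ₀ < ∞ := by
  classical
  -- ===== instances on the coordinate field `F′` =====
  haveI : T2Space F' := (isLocalField F').toT2Space
  haveI := secondCountableTopology_localField F'
  letI : MeasurableSpace F' := borel F'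
  haveI : BorelSpace F' := ⟨rfl⟩
  -- ===== the square of the skew unit is fixed: `lam² = ι m`, `m ≠ 0`; `2 ≠ 0` in `F′` =====
  obtain ⟨m, hm⟩ : ∃ m : F', ι m = (lam : K) ^ 2 := by
    obtain ⟨m, hm⟩ := (hιr ((lam : K) ^ 2)).1 (by rw [map_pow, hlam, neg_sq])
    exact ⟨m, hm⟩
  have hm0 : m ≠ 0 := by
    rintro rfl
    rw [map_zero] at hm
    exact (pow_ne_zero 2 lam.ne_zero) hm.symm
  have h2F : (2 : F') ≠ 0 := fun h => (Invertible.ne_zero (2 : K)) (by rw [← map_ofNat ι 2, h, map_zero])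
  -- ===== the chart and the instances on `↥𝔲` it transports =====
  obtain ⟨Φ, hΦ⟩ := exists_coords_lie_two σ hσ ι hι hιr lam hlam 𝔲 h𝔲
  haveI : LocallyCompactSpace ↥𝔲 := Φ.toHomeomorph.symm.isClosedEmbedding.locallyCompactSpace
  haveI : SecondCountableTopology ↥𝔲 := Φ.toHomeomorph.symm.secondCountableTopology
  -- ===== Haar measures on the coordinate spaces =====
  set μ : Measure F' := Measure.addHaar with hμ
  haveI : (Measure.pi fun _ : Fin 4 => μ).IsAddHaarMeasure := Measure.pi.isAddHaarMeasure _
  haveI : (Measure.pi fun _ : Fin 3 => μ).IsAddHaarMeasure := Measure.pi.isAddHaarMeasure _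
  -- ===== the three integrands =====
  set f : ↥𝔲 → ℝ≥0∞ := fun X =>
    ((normAbs K (Matrix.charpoly (X : Matrix (Fin 2) (Fin 2) K)).discr : ℝ≥0∞)) ^ (-r) with hfdef
  set g₄ : (Fin 4 → F') → ℝ≥0∞ := fun a => ((normAbs F' (4 * (a 0 ^ 2 + m * (a 2 * a 3))) : ℝ≥0∞)) ^ (-(2 * r)) with hg₄
  set g₃ : (Fin 3 → F') → ℝ≥0∞ := fun y =>
    ((normAbs F' (y ⬝ᵥ !![(4 : F'), 0, 0; 0, 0, 2 * m; 0, 2 * m, 0] *ᵥ y) : ℝ≥0∞)) ^ (-(2 * r)) with hg₃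
  have hfΦ : ∀ a : Fin 4 → F', f (Φ a) = g₄ a := fun a => eta_rpow_coords_eq ι hιn lam hm Φ hΦ r a
  have hg₃m : Measurable g₃ := by
    have hQc : Continuous fun y : Fin 3 → F' => y ⬝ᵥ !![(4 : F'), 0, 0; 0, 0, 2 * m; 0, 2 * m, 0] *ᵥ y :=
      continuous_id.dotProduct (continuous_const.matrix_mulVec continuous_id)
    exact ((measurable_normAbs.comp hQc.measurable).coe_nnreal_ennreal).pow_const _
  -- ===== ★ (D3b) at exponent `s = 2r < 1`: `‖Q‖^{−2r} ∈ L¹_loc(F′³)` =====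
  have hD3b := forall_exists_nhds_setLIntegral_ternaryQuadraticForm_rpow_neg_lt_top μ (gram_ternary_isSymm m) (gram_ternary_det_ne_zero hm0 h2F) h2F hr
  -- ===== the idle centre coordinate: product transfer =====
  obtain ⟨e, he⟩ := exists_prodChart_four F'
  have hfg : ∀ (z : F') (y : Fin 3 → F'), g₄ (e (z, y)) = g₃ y := fun z y => by
    simp only [hg₄, hg₃, he, dotProduct_gram_ternary, Matrix.cons_val_zero, Matrix.cons_val_two, Matrix.tail_cons, Matrix.head_cons,
      Matrix.cons_val_three]
  have h4 : ∀ a : Fin 4 → F', ∃ U ∈ 𝓝 a, ∫⁻ x in U, g₄ x ∂(Measure.pi fun _ : Fin 4 => μ) < ∞ :=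
    (forall_exists_nhds_setLIntegral_lt_top_iff_of_prod e (Measure.pi fun _ : Fin 3 => μ) (Measure.pi fun _ : Fin 4 => μ) μ hg₃m hfg).2 hD3b
  -- ===== transfer along the chart `Φ` =====
  refine (forall_exists_nhds_setLIntegral_lt_top_iff_of_addEquiv Φ (Measure.pi fun _ : Fin 4 => μ) μ₀ f).2 fun a => ?_
  obtain ⟨U, hU, hfin⟩ := h4 a
  refine ⟨U, hU, ?_⟩
  have hcongr : ∫⁻ v in U, f (Φ v) ∂(Measure.pi fun _ : Fin 4 => μ) = ∫⁻ v in U, g₄ v ∂(Measure.pi fun _ : Fin 4 => μ) :=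
    lintegral_congr fun v => hfΦ v
  rw [hcongr]
  exact hfin

end Head

end Summit.HodgeConjecture.HodgeConjecture.Cruxes.H413.K2E3U11WeylDiscrLieLocIntRpow

end
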